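import Summits.ValiantsHypothesis.ValiantsHypothesis.Theorems.DefinabilityGapActiveShared
import HarnessLib

/-!
# Definability gap, ROAD P: explicit constants for the crowded-line bound (N1 v2 (c))

`DefinabilityGapActiveShared.weight_fewFree_le` takes three quantities as hypotheses: a lower
bound `θ` for the private-block products `∏_{b ∈ priv j} (1 − w_b(τ j))`, an upper bound `A` for
the shared load, and the pair condition `htwo`.  This file discharges the first two from POINT
WEIGHTS `≤ p` and KILLER SETS OF SIZE `≤ N` (generic; the minors supply `p = 8/(5m)`,
`N = 32m` via `DefinabilityGapPivotFreeDict`):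

* `omega_le_mul_card`, `sum_sum_card_inter_le` (each killer in at most two killer sets ⟹
  `Σ_j Σ_{j' ≠ j} #(K j ∩ K j') ≤ Σ_j #K j`), `pairWeight_omega_le` (`≤ p Σ_j #K j`),
  `sharedLoad_le` (`≤ p N #J`);
* `exp_neg_two_mul_le_one_sub` (`e^{−2x} ≤ 1 − x` on `[0, 1/2]`), `exp_neg_le_prod_one_sub`,
  `theta_le_prod_priv` (`e^{−2pN} ≤ ∏_{b ∈ priv j} (1 − w_b(τ j))`);
* **`weight_fewFree_le_explicit`** — the crowded-line bound with `θ = e^{−2pN}`, `A = p N #J`.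
-/

namespace Summit.ValiantsHypothesis.ValiantsHypothesis.Theorems.DefinabilityGapPairWeightBound

open Finset Real Literature.Probability.Moments
open Summit.ValiantsHypothesis.ValiantsHypothesis.Theorems.DefinabilityGapSparseSubfamily
open Summit.ValiantsHypothesis.ValiantsHypothesis.Theorems.DefinabilityGapPrivateFree
open Summit.ValiantsHypothesis.ValiantsHypothesis.Theorems.DefinabilityGapActiveShared

variable {α β Γ : Type*} [DecidableEq α] [DecidableEq β]

/-! ## 1. Pair weights under point weights `≤ p` -/

omit [DecidableEq α] in
/-- `ω j j' ≤ p · #(K j ∩ K j')`. [this file] -/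
theorem omega_le_mul_card {w : β → Γ → ℝ} {p : ℝ} (hwp : ∀ b a, w b a ≤ p) (K : α → Finset β)
    (τ : α → Γ) (j j' : α) : omega w K τ j j' ≤ p * ((K j ∩ K j').card : ℝ) := by
  unfold omega
  calc ∑ b ∈ K j ∩ K j', w b (τ j) ≤ ∑ b ∈ K j ∩ K j', p :=
        Finset.sum_le_sum fun b _ => hwp b (τ j)
    _ = p * ((K j ∩ K j').card : ℝ) := by rw [Finset.sum_const, nsmul_eq_mul, mul_comm]

/-- **Each killer in at most two killer sets** ⟹ `Σ_j Σ_{j' ≠ j} #(K j ∩ K j') ≤ Σ_j #K j`.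
[this file] -/
theorem sum_sum_card_inter_le (K : α → Finset β) (J : Finset α)
    (htwo : ∀ b, (J.filter fun j => b ∈ K j).card ≤ 2) :
    ∑ j ∈ J, ∑ j' ∈ J.erase j, (K j ∩ K j').card ≤ ∑ j ∈ J, (K j).card := by
  refine Finset.sum_le_sum fun j hj => ?_
  have key : ∀ b ∈ K j, ((J.erase j).filter fun j' => b ∈ K j').card ≤ 1 := by
    intro b hb
    rw [Finset.filter_erase, Finset.card_erase_of_mem (Finset.mem_filter.mpr ⟨hj, hb⟩)]
    have := htwo b
    omega
  calc ∑ j' ∈ J.erase j, (K j ∩ K j').card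
      = ∑ j' ∈ J.erase j, ∑ b ∈ K j, (if b ∈ K j' then 1 else 0) := by
        refine Finset.sum_congr rfl fun j' _ => ?_
        rw [← Finset.filter_mem_eq_inter, Finset.card_filter]
    _ = ∑ b ∈ K j, ∑ j' ∈ J.erase j, (if b ∈ K j' then 1 else 0) := Finset.sum_comm
    _ = ∑ b ∈ K j, ((J.erase j).filter fun j' => b ∈ K j').card := by
        refine Finset.sum_congr rfl fun b _ => ?_
        rw [Finset.card_filter]
    _ ≤ ∑ b ∈ K j, 1 := Finset.sum_le_sum key
    _ = (K j).card := by simp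

/-- **Pair-weight bound**: `pairWeight ω J ≤ p · Σ_{j ∈ J} #K j`. [this file] -/
theorem pairWeight_omega_le {w : β → Γ → ℝ} {p : ℝ} (hp : 0 ≤ p) (hwp : ∀ b a, w b a ≤ p)
    (K : α → Finset β) (τ : α → Γ) (J : Finset α)
    (htwo : ∀ b, (J.filter fun j => b ∈ K j).card ≤ 2) :
    pairWeight (omega w K τ) J ≤ p * ∑ j ∈ J, ((K j).card : ℝ) := by
  unfold pairWeight
  calc ∑ j ∈ J, ∑ j' ∈ J.erase j, omega w K τ j j'
      ≤ ∑ j ∈ J, ∑ j' ∈ J.erase j, p * ((K j ∩ K j').card : ℝ) :=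
        Finset.sum_le_sum fun j _ => Finset.sum_le_sum fun j' _ => omega_le_mul_card hwp K τ j j'
    _ = p * ∑ j ∈ J, ∑ j' ∈ J.erase j, ((K j ∩ K j').card : ℝ) := by
        simp_rw [Finset.mul_sum]
    _ ≤ p * ∑ j ∈ J, ((K j).card : ℝ) := by
        have h := sum_sum_card_inter_le K J htwo
        have h' : ∑ j ∈ J, ∑ j' ∈ J.erase j, ((K j ∩ K j').card : ℝ) ≤
            ∑ j ∈ J, ((K j).card : ℝ) := by exact_mod_cast h
        exact mul_le_mul_of_nonneg_left h' hp

/-- **Shared-load bound**: killer sets of size `≤ N` give `sharedLoad ≤ p N #J`. [this file] -/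
theorem sharedLoad_le {w : β → Γ → ℝ} {p : ℝ} (hp : 0 ≤ p) (hw : ∀ b a, 0 ≤ w b a)
    (hwp : ∀ b a, w b a ≤ p) (K : α → Finset β) (τ : α → Γ) (J : Finset α)
    (htwo : ∀ b, (J.filter fun j => b ∈ K j).card ≤ 2) {N : ℕ}
    (hK : ∀ j ∈ J, (K j).card ≤ N) :
    sharedLoad w K τ J ≤ p * N * J.card := by
  have h1 := sharedLoad_le_pairWeight hw K τ J
  have h2 := pairWeight_omega_le hp hwp K τ J htwo
  have h3 : ∑ j ∈ J, ((K j).card : ℝ) ≤ N * J.card := by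
    calc ∑ j ∈ J, ((K j).card : ℝ) ≤ ∑ j ∈ J, (N : ℝ) :=
          Finset.sum_le_sum fun j hj => by exact_mod_cast hK j hj
      _ = N * J.card := by rw [Finset.sum_const, nsmul_eq_mul, mul_comm]
  calc sharedLoad w K τ J ≤ p * ∑ j ∈ J, ((K j).card : ℝ) := h1.trans h2
    _ ≤ p * (N * J.card) := mul_le_mul_of_nonneg_left h3 hp
    _ = p * N * J.card := by ring

/-! ## 2. The private-block products are bounded below -/

/-- `e^{−2x} ≤ 1 − x` for `0 ≤ x ≤ 1/2`. [this file] -/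
theorem exp_neg_two_mul_le_one_sub {x : ℝ} (hx0 : 0 ≤ x) (hx : x ≤ 1 / 2) :
    exp (-(2 * x)) ≤ 1 - x := by
  have h1 : 1 + 2 * x ≤ exp (2 * x) := by
    have := Real.add_one_le_exp (2 * x)
    linarith
  have h3 : exp (-(2 * x)) * exp (2 * x) = 1 := by
    rw [← Real.exp_add]
    simp
  have h4 : 1 ≤ (1 - x) * exp (2 * x) := by
    have h5 : (1 - x) * (1 + 2 * x) ≤ (1 - x) * exp (2 * x) :=
      mul_le_mul_of_nonneg_left h1 (by linarith)
    nlinarith [mul_nonneg hx0 (by linarith : (0 : ℝ) ≤ 1 - 2 * x)]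
  calc exp (-(2 * x)) = exp (-(2 * x)) * 1 := (mul_one _).symm
    _ ≤ exp (-(2 * x)) * ((1 - x) * exp (2 * x)) :=
        mul_le_mul_of_nonneg_left h4 (exp_pos _).le
    _ = 1 - x := by rw [mul_comm (1 - x), ← mul_assoc, h3, one_mul]

/-- `e^{−2pN} ≤ ∏_{i ∈ S} (1 − f i)` when `0 ≤ f ≤ p ≤ 1/2` on `S` and `#S ≤ N`. [this file] -/
theorem exp_neg_le_prod_one_sub {ι : Type*} (S : Finset ι) (f : ι → ℝ) {p : ℝ} (hp0 : 0 ≤ p)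
    (hp : p ≤ 1 / 2) (hfp : ∀ i ∈ S, f i ≤ p) {N : ℕ} (hS : S.card ≤ N) :
    exp (-(2 * p * N)) ≤ ∏ i ∈ S, (1 - f i) := by
  have h1 : exp (-(2 * p * S.card)) = ∏ _i ∈ S, exp (-(2 * p)) := by
    rw [Finset.prod_const, ← Real.exp_nat_mul]
    congr 1
    ring
  have h2 : exp (-(2 * p * N)) ≤ exp (-(2 * p * S.card)) := by
    apply Real.exp_le_exp.mpr
    have : (S.card : ℝ) ≤ N := by exact_mod_cast hS
    nlinarith
  refine h2.trans ?_
  rw [h1]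
  refine Finset.prod_le_prod (fun i _ => (exp_pos _).le) fun i hi => ?_
  calc exp (-(2 * p)) ≤ 1 - p := exp_neg_two_mul_le_one_sub hp0 hp
    _ ≤ 1 - f i := by linarith [hfp i hi]

/-- **θ = e^{−2pN}** bounds the private-block products: killer sets of size `≤ N`, point weights
`≤ p ≤ 1/2`. [this file] -/
theorem theta_le_prod_priv {w : β → Γ → ℝ} {p : ℝ} (hp0 : 0 ≤ p) (hp : p ≤ 1 / 2)
    (hwp : ∀ b a, w b a ≤ p) (K : α → Finset β) (τ : α → Γ) (J : Finset α) {N : ℕ}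
    (hK : ∀ j ∈ J, (K j).card ≤ N) {j : α} (hj : j ∈ J) :
    exp (-(2 * p * N)) ≤ ∏ b ∈ priv K J j, (1 - w b (τ j)) :=
  exp_neg_le_prod_one_sub (priv K J j) (fun b => w b (τ j)) hp0 hp (fun b _ => hwp b _)
    ((Finset.card_le_card (Finset.filter_subset _ (K j))).trans (hK j hj))

/-! ## 3. The crowded-line bound with explicit constants -/

open scoped Classical in
/-- **Crowded-line bound, explicit form.**  Point weights `≤ p ≤ 1/2`, killer sets of size `≤ N`
(`N ≥ 1`), each killer in at most two of them, `J` nonempty: the assignments leaving fewer than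
`e^{−2pN} #J / 2 − 2 (p N #J + t)` cells of `J` free weigh at most
`exp(−e^{−2pN} #J / 8) + exp(−t²/(2 (p N #J + t/3)))`. [this file] -/
theorem weight_fewFree_le_explicit [Fintype β] [Fintype Γ] [DecidableEq Γ] {w : β → Γ → ℝ}
    (hw : ∀ b a, 0 ≤ w b a) (hw1 : ∀ b, ∑ a, w b a = 1) {p : ℝ} (hp0 : 0 < p)
    (hp : p ≤ 1 / 2) (hwp : ∀ b a, w b a ≤ p) (K : α → Finset β) (τ : α → Γ) (J : Finset α)
    (hJ : J.Nonempty) (htwo : ∀ b, (J.filter fun j => b ∈ K j).card ≤ 2) {N : ℕ} (hN : 0 < N)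
    (hK : ∀ j ∈ J, (K j).card ≤ N) {t : ℝ} (ht : 0 < t) :
    ∑ r ∈ (Finset.univ : Finset (β → Γ)).filter
        (fun r => ((J.filter (free K (fun j b => r b = τ j))).card : ℝ) <
          exp (-(2 * p * N)) * J.card / 2 - 2 * (p * N * J.card + t)), prodWeight w r
      ≤ exp (-(exp (-(2 * p * N)) * J.card / 8)) +
        exp (-(t ^ 2 / (2 * (p * N * J.card + 1 * t / 3)))) := by
  have hApos : 0 < p * N * J.card :=
    mul_pos (mul_pos hp0 (by exact_mod_cast hN)) (by exact_mod_cast hJ.card_pos)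
  exact weight_fewFree_le hw hw1 K τ J htwo (exp_pos _).le
    (fun j hj => theta_le_prod_priv hp0.le hp hwp K τ J hK hj)
    (sharedLoad_le hp0.le hw hwp K τ J htwo hK) hApos ht

end Summit.ValiantsHypothesis.ValiantsHypothesis.Theorems.DefinabilityGapPairWeightBound
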